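import Summits.FinalStateConjecture.FinalStateConjecture.Theses.PhotonSphereChannels

/-!
# Boost-blindness of the tameness clause (negative-side read-back support for crux `TameCensorship`,
`stmt-FinalStateConjecture-10047`, cdisprove seat, cycle 2)

Clause (iv) of `PhotonSphereChannels.TameCensorship` (= hypothesis (ii) of
`ChannelsResolveTameDevelopments`) asks, for each point `q` of the outer region separately, for SOME chart
`Ψ` from the coordinate ball `B(0, r₀) ⊆ E4` with `Ψ(0) = q`, `Ψ^* g` within `1/2` of `η` in `C⁰` and
within `Λ` in `C³`. Exact `η`-isometries of `E4` compose with such charts. This file proves the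
linear-algebra core of the resulting blindness:

* `boostCLM`, `boost`, `boost_mem_lorentzGroup` — the boosts of the `(x⁰, x³)`-plane are elements of the
  prelude's `lorentzGroup = O(1,3)`;
* `exists_lorentz_ball_disjoint_translate` — for every `ℓ > 0`, `r₀ > 0` some `Λ ∈ O(1,3)` has
  `Λ w − Λ w' ≠ ℓ e₃` for all `w, w' ∈ B(0, r₀)`: an `η`-ISOMETRIC linear image of the `r₀`-ball is
  disjoint from its translate by an arbitrarily short spacelike vector.

Hence in the flat Lorentzian cylinder `E4 ⧸ ℤ ℓ e₃` boosted charts are injective isometric `r₀`-ball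
charts at every point although closed spacelike geodesics have length `ℓ ≪ r₀`: "bounded geometry at a
uniform scale" as typed does not see short spacelike circles (nor, boosting along the wave vector, null
curvature of any strength — pp-waves); violating (iv) requires a frame-independent blow-up at scale
`r₀`. This weakens (iv) as a hypothesis (the burden of K2's provers) and makes K3's clause (iv) harder
to violate (the disprover's reading of triage finding R1, hidden expanding sectors).
-/

noncomputable section

open Bundle TopologicalSpace Manifold Set
open scoped ContDiff Topology InnerProductSpace RealInnerProductSpace

namespace Summit.FinalStateConjecture.FinalStateConjecture.Theorems.TameCensorship.Negative

open Literature.Geometry.Lorentzian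

/-- The boost of rapidity `χ` in the `(x⁰, x³)`-plane, as a continuous linear self-map of `E4`:
`(Bv)⁰ = cosh χ v⁰ + sinh χ v³`, `(Bv)³ = sinh χ v⁰ + cosh χ v³`, `(Bv)¹ = v¹`, `(Bv)² = v²`. -/
def boostCLM (χ : ℝ) : E4 →L[ℝ] E4 :=
  ContinuousLinearMap.id ℝ E4
    + (Real.cosh χ - 1) • ContinuousLinearMap.smulRight (EuclideanSpace.proj (0 : Fin 4))
        (EuclideanSpace.single (0 : Fin 4) (1 : ℝ))
    + Real.sinh χ • ContinuousLinearMap.smulRight (EuclideanSpace.proj (3 : Fin 4))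
        (EuclideanSpace.single (0 : Fin 4) (1 : ℝ))
    + Real.sinh χ • ContinuousLinearMap.smulRight (EuclideanSpace.proj (0 : Fin 4))
        (EuclideanSpace.single (3 : Fin 4) (1 : ℝ))
    + (Real.cosh χ - 1) • ContinuousLinearMap.smulRight (EuclideanSpace.proj (3 : Fin 4))
        (EuclideanSpace.single (3 : Fin 4) (1 : ℝ))

/-- Time component of the boost. -/
@[simp] theorem boostCLM_apply_zero (χ : ℝ) (v : E4) :
    boostCLM χ v 0 = Real.cosh χ * v 0 + Real.sinh χ * v 3 := by
  simp [boostCLM]; ring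

/-- `x³`-component of the boost. -/
@[simp] theorem boostCLM_apply_three (χ : ℝ) (v : E4) :
    boostCLM χ v 3 = Real.sinh χ * v 0 + Real.cosh χ * v 3 := by
  simp [boostCLM]; ring

/-- The boost fixes `x¹`. -/
@[simp] theorem boostCLM_apply_one (χ : ℝ) (v : E4) : boostCLM χ v 1 = v 1 := by
  simp [boostCLM]

/-- The boost fixes `x²`. -/
@[simp] theorem boostCLM_apply_two (χ : ℝ) (v : E4) : boostCLM χ v 2 = v 2 := by
  simp [boostCLM]

/-- `B(−χ) ∘ B(χ) = id` (`cosh² − sinh² = 1`). -/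
theorem boostCLM_neg_apply_apply (χ : ℝ) (v : E4) : boostCLM (-χ) (boostCLM χ v) = v := by
  have h := Real.cosh_sq χ
  ext j
  fin_cases j
  · simp [Real.cosh_neg, Real.sinh_neg]
    linear_combination (v 0) * h
  · simp
  · simp
  · simp [Real.cosh_neg, Real.sinh_neg]
    linear_combination (v 3) * h

/-- The boost as a continuous linear automorphism of `E4`. -/
def boost (χ : ℝ) : E4 ≃L[ℝ] E4 :=
  ContinuousLinearEquiv.equivOfInverse (boostCLM χ) (boostCLM (-χ))
    (boostCLM_neg_apply_apply χ) (fun v ↦ by simpa using boostCLM_neg_apply_apply (-χ) v)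

/-- Unfolding lemma. -/
@[simp] theorem boost_apply (χ : ℝ) (v : E4) : boost χ v = boostCLM χ v := rfl

/-- **Boosts are Lorentz transformations** of the prelude's `lorentzGroup = O(1,3)`. -/
theorem boost_mem_lorentzGroup (χ : ℝ) : boost χ ∈ lorentzGroup := by
  rw [mem_lorentzGroup_iff]
  intro v w
  have h := Real.cosh_sq χ
  change Minkowski.bilin (boostCLM χ v) (boostCLM χ w) = Minkowski.bilin v w
  have e1 : ((1 : Fin 3).succ : Fin 4) = 2 := rfl
  have e2 : ((2 : Fin 3).succ : Fin 4) = 3 := rfl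
  have e0 : ((0 : Fin 3).succ : Fin 4) = 1 := rfl
  simp only [Minkowski.bilin_apply, Fin.sum_univ_three, e0, e1, e2, boostCLM_apply_zero,
    boostCLM_apply_one, boostCLM_apply_two, boostCLM_apply_three]
  linear_combination (v 3 * w 3 - v 0 * w 0) * h

/-- A coordinate of a vector of `E4` is bounded by its norm. -/
theorem abs_apply_le_norm (v : E4) (i : Fin 4) : |v i| ≤ ‖v‖ := by
  rw [EuclideanSpace.norm_eq]
  apply Real.abs_le_sqrt
  have := Finset.single_le_sum (f := fun j : Fin 4 ↦ ‖v j‖ ^ 2) (fun j _ ↦ sq_nonneg _)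
    (Finset.mem_univ i)
  simpa [Real.norm_eq_abs, sq_abs] using this

/-- **Boost-blindness of the chart clause.** For every `ℓ > 0` and `r₀ > 0` there is a Lorentz
transformation `Λ ∈ O(1,3)` such that the `η`-ISOMETRIC linear image `Λ(B(0, r₀))` of the coordinate
`r₀`-ball is disjoint from its translate by the short spacelike vector `ℓ e₃`:
`Λ w − Λ w' ≠ ℓ e₃` for all `w, w' ∈ B(0, r₀)` (take the boost of rapidity `χ = 2 r₀ / ℓ` in the
`(x⁰, x³)`-plane: a difference `Λ(w − w') = ℓ e₃` forces `|(w − w')⁰| = ℓ sinh χ ≥ 2 r₀`).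
READ-BACK CONSEQUENCE for clause (iv) of `TameCensorship` (and hypothesis (ii) of
`ChannelsResolveTameDevelopments`): the clause asks, at each point separately, for SOME chart from the
`r₀`-ball with `Ψ^* g` `C⁰`-close to `η`, and an exact `η`-isometry composed with such a chart is again
such a chart; so in the flat Lorentzian cylinder `E4 ⧸ ℤ ℓ e₃` the boosted charts `x ↦ [Λ x + q]` are
injective isometric `r₀`-ball charts at every point although the closed spacelike geodesics have length
`ℓ ≪ r₀`. "Bounded geometry at a uniform scale" as typed therefore does NOT see short closed spacelike
circles (e.g. the contracting circle of a Kasner-like expanding hidden sector, triage R1), nor — boosting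
along the wave vector — null curvature of any strength (pp-waves); violating (iv) requires a
frame-INDEPENDENT blow-up at scale `r₀` along `outer` (curvature invariants, or the boundary of the MGHD
within uniform reach in every frame). This weakens (iv) as a hypothesis (K2's burden) and strengthens the
case that K3's clause (iv) is hard to violate generically. -/
theorem exists_lorentz_ball_disjoint_translate {ℓ r₀ : ℝ} (hℓ : 0 < ℓ) (hr : 0 < r₀) :
    ∃ Λ : E4 ≃L[ℝ] E4, Λ ∈ lorentzGroup ∧
      ∀ w ∈ Metric.ball (0 : E4) r₀, ∀ w' ∈ Metric.ball (0 : E4) r₀,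
        Λ w - Λ w' ≠ ℓ • EuclideanSpace.single (3 : Fin 4) (1 : ℝ) := by
  set χ : ℝ := 2 * r₀ / ℓ with hχ
  have hχ0 : 0 ≤ χ := by positivity
  refine ⟨boost χ, boost_mem_lorentzGroup χ, fun w hw w' hw' h ↦ ?_⟩
  rw [Metric.mem_ball, dist_zero_right] at hw hw'
  set u : E4 := w - w' with hu
  have hBu : boost χ u = ℓ • EuclideanSpace.single (3 : Fin 4) (1 : ℝ) := by
    rw [hu, map_sub]; exact h
  have h0 := congrArg (fun v : E4 ↦ v 0) hBu
  have h3 := congrArg (fun v : E4 ↦ v 3) hBu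
  simp at h0 h3
  -- solve the 2×2 system: u 0 = -ℓ sinh χ
  have hcs := Real.cosh_sq χ
  have hu0 : u 0 = -(ℓ * Real.sinh χ) := by
    linear_combination Real.cosh χ * h0 - Real.sinh χ * h3 - (u 0) * hcs
  -- |u 0| ≥ ℓ χ = 2 r₀
  have hsinh : χ ≤ Real.sinh χ := Real.self_le_sinh_iff.2 hχ0
  have hge : 2 * r₀ ≤ |u 0| := by
    rw [hu0, abs_neg, abs_of_nonneg (by positivity)]
    calc 2 * r₀ = ℓ * χ := by rw [hχ]; field_simp
      _ ≤ ℓ * Real.sinh χ := mul_le_mul_of_nonneg_left hsinh hℓ.le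
  -- but |u 0| ≤ ‖u‖ < 2 r₀
  have hlt : |u 0| < 2 * r₀ :=
    calc |u 0| ≤ ‖u‖ := abs_apply_le_norm u 0
      _ ≤ ‖w‖ + ‖w'‖ := norm_sub_le w w'
      _ < 2 * r₀ := by linarith
  linarith

end Summit.FinalStateConjecture.FinalStateConjecture.Theorems.TameCensorship.Negative

end
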